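import Literature.AnabelianGeometry.AbsoluteAnabelian.AbsTopIII.ReconstructionCor110iaNaturalFund
import Literature.AnabelianGeometry.AbsoluteAnabelian.AbsTopIII.ReconstructionCor110iaResNaturalProofs
import Literature.AnabelianGeometry.EtaleTheta.ZHatLevelDetermination
import HarnessLib

/-!
# [AbsTopIII] Cor. 1.10 (i)(a) PINNED on THE fundamental datum — closer and UNIQUENESS of the family

Mochizuki, *Topics in Absolute Anabelian Geometry III*, Cor. 1.10 (i)(a) p. 42 («the natural isomorphism
`H²(G_k, μ_Ẑ(G_k)) ⥲ Ẑ` … via the algorithm described in the proof of [Mzk9], Proposition 1.2.1, (vii)»).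
PROOF-ONLY companion (abc-iut layer L4, row «COR110i-OPEN-INJ+FUND», abc-iut-L4-d3) of
`ReconstructionCor110iaNaturalFund.lean`:

* `Cor110iaNat.datum_eq_fundamental` — abc-iut-L4-d1's characterised datum `Cor110iaNat.datum k`
  (`Classical.choose exists_torsionReciprocityData_levelChar`) IS `TorsionReciprocityData.fundamental k`
  (same `Exists.choose`, the predicate `IsFundamental` being that clause VERBATIM) — so THE family of record
  `Cor110iaNat.residueIso` is built on THE fundamental identification;
* `AbsTopIII.cor_1_10_i_a_natural_fund_holds` — the pinned Prop is PROVED by `Cor110iaNat.residueIso`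
  ((1♭) `Cor110iaNat.level_residueIso`, (2) `Cor110iaNat.residueIso_natural` (abc-iut-L4-d1, p438943), (3)
  `Cor110iaNat.residueIso_galCyclotomeRes_of_compatible` + abc-iut-L4-t11's restriction compatibility
  `Cor110Open.levelChar_equiv_eq_inducedCyclotomeEquiv`);
* `AbsTopIII.Cor_1_10_i_a_natural_fund.eq_of_clause_one` — **UNIQUENESS**: two families satisfying (1♭) are
  equal (an element of `Ẑ` is determined by its levels, `ZHatLevel.ext_of_level`); in particular every witness of
  `Cor_1_10_i_a_natural_fund` IS `Cor110iaNat.residueIso` (`eq_residueIso`), and the pinned Prop implies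
  abc-iut-L4-d1's ∃φ-forms (`cor_1_10_i_a_resNatural_of_fund`, `cor_1_10_i_a_natural_of_fund`).

Theorems only; no named fact, no `sorry`.  HONEST FRAMING: classical local class field theory; nothing here
bears on [IUTchIII] Cor. 3.12 or takes a side.
-/

noncomputable section

open CategoryTheory Function
open Field ValuativeRel
open ProfiniteGrp ProfiniteGrp.ProfiniteCompletion

namespace Literature.AnabelianGeometry.AbsoluteAnabelian

open _root_.TopRep _root_.ContRepresentation _root_.ContinuousCohomology
open Literature.NumberTheory.GaloisRepresentations
open Literature.NumberTheory.GaloisRepresentations.DiscreteGaloisModule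
open Literature.AnabelianGeometry.EtaleTheta Literature.AnabelianGeometry.EtaleTheta.ZHatLevel

namespace Cor110iaNat

variable (k : Type) [Field k] [ValuativeRel k] [TopologicalSpace k] [IsNonarchimedeanLocalField k] [CharZero k]

/-- **THE characterised datum of abc-iut-L4-d1 IS THE fundamental datum** (`IsFundamental` is the
characterising clause of `exists_torsionReciprocityData_levelChar` verbatim, and `fundamental k` is chosen from
the same existence statement). [cite: MochizukiAbsAnab2004, Prop 1.2.1 (vi) p.10] -/
theorem datum_eq_fundamental : datum k = TorsionReciprocityData.fundamental k :=
  TorsionReciprocityData.IsFundamental.eq_fundamental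
    (Classical.choose_spec (exists_torsionReciprocityData_levelChar k))

/-- THE identification `i_k` of abc-iut-L4-d1 is the one built on `fundamental k`.
[cite: MochizukiAbsTopIII2015, Cor 1.10 (i) p.42] -/
theorem iso_eq_fundamental : iso k = galCyclotomeIsoTateModule k (TorsionReciprocityData.fundamental k).equiv
    (TorsionReciprocityData.fundamental k).equiv_smul := by
  change galCyclotomeIsoTateModule k (datum k).equiv (datum k).equiv_smul = _
  rw [datum_eq_fundamental]

/-- (1♭): `r_k = Cor110iaNat.residueIso k` is levelwise THE invariant map read through THE FUNDAMENTAL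
identification. [cite: MochizukiAbsTopIII2015, Cor 1.10 (i) p.42] -/
theorem level_residueIso_fund (x : galCyclotomeH2 (absoluteGaloisGroup k)) (n : ℕ+) :
    Multiplicative.toAdd (level n (Additive.toMul (residueIso k x))) =
      invMap k n (cohomologyMap ((muSystem k).projHom n) 2
        ((cohomologyMap (galCyclotomeIsoTateModule k (TorsionReciprocityData.fundamental k).equiv
          (TorsionReciprocityData.fundamental k).equiv_smul).hom 2).hom x)) := by
  rw [level_residueIso, ← iso_eq_fundamental]

end Cor110iaNat

namespace AbsTopIII

/-- **[AbsTopIII] Cor. 1.10 (i)(a) PINNED on THE fundamental datum — PROVED**, witnessed by THE family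
`Cor110iaNat.residueIso`: (1♭) `Cor110iaNat.level_residueIso_fund`, (2) `Cor110iaNat.residueIso_natural`,
(3) `Cor110iaNat.residueIso_galCyclotomeRes_of_compatible` with abc-iut-L4-t11's restriction compatibility of THE
identifications. [cite: MochizukiAbsTopIII2015, Cor 1.10 (i) p.42] -/
theorem cor_1_10_i_a_natural_fund_holds : Cor_1_10_i_a_natural_fund :=
  ⟨fun k _ _ _ _ _ => Cor110iaNat.residueIso k,
    fun k _ _ _ _ _ x n => Cor110iaNat.level_residueIso_fund k x n,
    fun _ _ _ _ _ _ _ _ _ _ _ _ α x => Cor110iaNat.residueIso_natural α x,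
    fun k _ _ _ _ _ k' _ _ _ _ _ _ _ x =>
      Cor110iaNat.residueIso_galCyclotomeRes_of_compatible k k'
        (fun y => Cor110Open.levelChar_equiv_eq_inducedCyclotomeEquiv k k' y) x⟩

/-- `Cor_1_10_i_a_natural_fund` — `_holds` alias of `cor_1_10_i_a_natural_fund_holds` above under the fact's exact name (appended
2026-08-28, D-0026 bookkeeping: the proof term is the existing theorem of this file; no statement,
definition or attribute is edited; no new named fact; the ledger's debt table listed the fact
unproved). [cite: MochizukiAbsTopIII2015, Cor 1.10 (i) p.42] -/
theorem _root_.Literature.AnabelianGeometry.AbsoluteAnabelian.AbsTopIII.Cor_1_10_i_a_natural_fund_holds :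
    Cor_1_10_i_a_natural_fund :=
  _root_.Literature.AnabelianGeometry.AbsoluteAnabelian.AbsTopIII.cor_1_10_i_a_natural_fund_holds

/-- **UNIQUENESS from clause (1♭) alone**: two families `r`, `r′` whose levels are THE invariant maps through THE
fundamental identification coincide (an element of `Ẑ` is determined by its levels).
[cite: MochizukiAbsTopIII2015, Cor 1.10 (i) p.42] -/
theorem Cor_1_10_i_a_natural_fund.eq_of_clause_one
    (r r' : ∀ (k : Type) [Field k] [ValuativeRel k] [TopologicalSpace k] [IsNonarchimedeanLocalField k]
      [CharZero k], galCyclotomeH2 (absoluteGaloisGroup k) ≃+ Additive (completion (GrpCat.of (Multiplicative ℤ))))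
    (hr : ∀ (k : Type) [Field k] [ValuativeRel k] [TopologicalSpace k] [IsNonarchimedeanLocalField k]
      [CharZero k] (x : galCyclotomeH2 (absoluteGaloisGroup k)) (n : ℕ+),
      Multiplicative.toAdd (level n (Additive.toMul (r k x))) =
        invMap k n (cohomologyMap ((muSystem k).projHom n) 2
          ((cohomologyMap (galCyclotomeIsoTateModule k (TorsionReciprocityData.fundamental k).equiv
            (TorsionReciprocityData.fundamental k).equiv_smul).hom 2).hom x)))
    (hr' : ∀ (k : Type) [Field k] [ValuativeRel k] [TopologicalSpace k] [IsNonarchimedeanLocalField k]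
      [CharZero k] (x : galCyclotomeH2 (absoluteGaloisGroup k)) (n : ℕ+),
      Multiplicative.toAdd (level n (Additive.toMul (r' k x))) =
        invMap k n (cohomologyMap ((muSystem k).projHom n) 2
          ((cohomologyMap (galCyclotomeIsoTateModule k (TorsionReciprocityData.fundamental k).equiv
            (TorsionReciprocityData.fundamental k).equiv_smul).hom 2).hom x)))
    (k : Type) [Field k] [ValuativeRel k] [TopologicalSpace k] [IsNonarchimedeanLocalField k] [CharZero k]
    (x : galCyclotomeH2 (absoluteGaloisGroup k)) : r k x = r' k x := by
  apply Additive.toMul.injective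
  refine ext_of_level fun n => ?_
  apply Multiplicative.toAdd.injective
  rw [hr k x n, hr' k x n]

/-- **Every witness family of the pinned Prop IS THE family `Cor110iaNat.residueIso`.**
[cite: MochizukiAbsTopIII2015, Cor 1.10 (i) p.42] -/
theorem Cor_1_10_i_a_natural_fund.eq_residueIso
    (r : ∀ (k : Type) [Field k] [ValuativeRel k] [TopologicalSpace k] [IsNonarchimedeanLocalField k]
      [CharZero k], galCyclotomeH2 (absoluteGaloisGroup k) ≃+ Additive (completion (GrpCat.of (Multiplicative ℤ))))
    (hr : ∀ (k : Type) [Field k] [ValuativeRel k] [TopologicalSpace k] [IsNonarchimedeanLocalField k]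
      [CharZero k] (x : galCyclotomeH2 (absoluteGaloisGroup k)) (n : ℕ+),
      Multiplicative.toAdd (level n (Additive.toMul (r k x))) =
        invMap k n (cohomologyMap ((muSystem k).projHom n) 2
          ((cohomologyMap (galCyclotomeIsoTateModule k (TorsionReciprocityData.fundamental k).equiv
            (TorsionReciprocityData.fundamental k).equiv_smul).hom 2).hom x)))
    (k : Type) [Field k] [ValuativeRel k] [TopologicalSpace k] [IsNonarchimedeanLocalField k] [CharZero k]
    (x : galCyclotomeH2 (absoluteGaloisGroup k)) : r k x = Cor110iaNat.residueIso k x :=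
  Cor_1_10_i_a_natural_fund.eq_of_clause_one r (fun k _ _ _ _ _ => Cor110iaNat.residueIso k) hr
    (fun k _ _ _ _ _ x n => Cor110iaNat.level_residueIso_fund k x n) k x

/-- The pinned form implies abc-iut-L4-d1's `Cor_1_10_i_a_resNatural` (take `φ := (fundamental k).equiv`).
[cite: MochizukiAbsTopIII2015, Remark 1.10.1 p.44] -/
theorem cor_1_10_i_a_resNatural_of_fund (h : Cor_1_10_i_a_natural_fund) : Cor_1_10_i_a_resNatural := by
  obtain ⟨r, h₁, h₂, h₃⟩ := h
  exact ⟨r, fun k _ _ _ _ _ => ⟨(TorsionReciprocityData.fundamental k).equiv,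
    (TorsionReciprocityData.fundamental k).equiv_smul, fun x n => h₁ k x n⟩, h₂, h₃⟩

/-- The pinned form implies abc-iut-L4-d1's `Cor_1_10_i_a_natural`.
[cite: MochizukiAbsTopIII2015, Cor 1.10 (i) p.42] -/
theorem cor_1_10_i_a_natural_of_fund (h : Cor_1_10_i_a_natural_fund) : Cor_1_10_i_a_natural :=
  cor_1_10_i_a_natural_of_resNatural (cor_1_10_i_a_resNatural_of_fund h)

end AbsTopIII

end Literature.AnabelianGeometry.AbsoluteAnabelian
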